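import Literature.Topology.FourManifolds.CerfPropositionFourProofs
import Literature.Topology.FourManifolds.DiffeotopyTransportProofs
import Mathlib.Analysis.Normed.Module.HahnBanach
import HarnessLib

/-!
# Reductions for `π₀(Diff(Dⁿ; Sⁿ⁻¹)) = 0`: radius-free form, linear transport, fibrewise convexity

Topic `Literature/Topology/FourManifolds`; sequel to `CerfPropositionFourProofs.lean` (continuous
versus smooth paths in Cerf's group `𝒦`). This file collects the elementary reductions used by
Smale's proof that `Diff(D² rel ∂)` is connected (S. Smale, *Diffeomorphisms of the 2-sphere*,
Proc. AMS 10 (1959), Thm. B; J. Cerf, *Sur les difféomorphismes de la sphère de dimension trois*,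
LNM 53 (1968), Appendice §5, Théorème 4 "le théorème de Smale") in the tree's model of `𝒦`
(diffeomorphisms of a normed space equal to the identity off a ball, smooth paths =
`Literature.Topology.FourManifolds.Diffeotopy`):

* `exists_compactDiffeotopy_trans`, `exists_compactDiffeotopy_symm` — the diffeomorphisms reached
  by compactly supported diffeotopies form a subgroup;
* `CompactDiffeotopyTrivial.of_continuousLinearEquiv`,
  `UnitBallDiffeotopyTrivial.of_continuousLinearEquiv` — transport of the radius-free form
  `Literature.Topology.FourManifolds.CompactDiffeotopyTrivial E` along any continuous linear
  equivalence `E ≃L[ℝ] E'`, and of the unit-ball form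
  `Literature.Topology.FourManifolds.UnitBallDiffeotopyTrivial E` through the equivalence of the
  two forms (`UnitBallDiffeotopyTrivial.of_compact`, `DiffeotopyTransportProofs.lean`); so the
  statement for `ℝ²` may be proved in `ℂ` or `ℝ × ℝ` and moved to `EuclideanSpace ℝ (Fin 2)`;
* `exists_compactDiffeotopy_of_forall_sub_mem_span` — **fibrewise convexity** (Cerf 1968, App. §5,
  p. 131: "le groupe des difféomorphismes de `R` conservant l'orientation est convexe"; the last
  step of Smale's proof): a compactly supported diffeomorphism `u` of a real normed space `E`
  which moves every point only in a fixed direction `e₁` (`u p - p ∈ ℝ e₁`) is the time-one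
  stage of the straight-line diffeotopy `p + λ(t)(u p - p)`, compactly supported — on each line
  `p + ℝ e₁` the map `u` is an increasing diffeomorphism of `ℝ`, and the derivative of a stage is
  a rank-one perturbation of the identity with positive pivot;
* `exists_compactDiffeotopy_of_straightening` — hence (Smale's scheme) a compactly supported
  diffeomorphism `s` is reached by a compactly supported diffeotopy as soon as some `Φ` reached
  by one satisfies `s⁻¹ (Φ p) - p ∈ ℝ e₁` for all `p` (`Φ` "straightens" the image under `s` of
  the foliation by lines parallel to `e₁`).

Everything here is proved; no definitions, no named facts.

## References

* S. Smale, *Diffeomorphisms of the 2-sphere*, Proc. Amer. Math. Soc. 10 (1959) 621–626, Thm. B.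
* J. Cerf, *Sur les difféomorphismes de la sphère de dimension trois (Γ₄ = 0)*, Lecture Notes in
  Mathematics 53, Springer (1968), Ch. I §1, p. 2; Appendice §5, Théorème 4 and p. 131.
  [CerfDiffeoSphere1968]
* M. W. Hirsch, *Differential Topology*, GTM 33 (1976), Ch. 8 §1 (diffeotopies; convex
  combination of embeddings `ℝ → ℝ`). [HirschDT1976]
-/

open scoped Manifold ContDiff Topology
open Function Set Filter Metric

noncomputable section

namespace Literature.Topology.FourManifolds

/-! ### The subgroup of diffeomorphisms reached by compactly supported diffeotopies -/

section Group

variable {E : Type*} [NormedAddCommGroup E] [NormedSpace ℝ E]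

/-- **Closure under composition** (compose the diffeotopies stagewise; the supports add up to
the larger ball). [folklore] -/
theorem exists_compactDiffeotopy_trans {s₁ s₂ : E ≃ₘ⟮𝓘(ℝ, E), 𝓘(ℝ, E)⟯ E}
    (h₁ : ∃ D : Diffeotopy 𝓘(ℝ, E) E, D.stage 1 = s₁ ∧ ∃ R, ∀ t y, R ≤ ‖y‖ → D.toFun t y = y)
    (h₂ : ∃ D : Diffeotopy 𝓘(ℝ, E) E, D.stage 1 = s₂ ∧ ∃ R, ∀ t y, R ≤ ‖y‖ → D.toFun t y = y) :
    ∃ D : Diffeotopy 𝓘(ℝ, E) E, D.stage 1 = s₁.trans s₂ ∧ ∃ R, ∀ t y, R ≤ ‖y‖ → D.toFun t y = y := by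
  obtain ⟨D₁, rfl, R₁, h₁s⟩ := h₁
  obtain ⟨D₂, rfl, R₂, h₂s⟩ := h₂
  refine ⟨D₁.trans D₂, Diffeomorph.ext fun x => by simp, max R₁ R₂, fun t y hy => ?_⟩
  rw [Diffeotopy.trans_toFun, comp_apply, h₁s t y ((le_max_left _ _).trans hy),
    h₂s t y ((le_max_right _ _).trans hy)]

/-- **Closure under inversion** (invert stagewise). [folklore] -/
theorem exists_compactDiffeotopy_symm {s : E ≃ₘ⟮𝓘(ℝ, E), 𝓘(ℝ, E)⟯ E}
    (h : ∃ D : Diffeotopy 𝓘(ℝ, E) E, D.stage 1 = s ∧ ∃ R, ∀ t y, R ≤ ‖y‖ → D.toFun t y = y) :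
    ∃ D : Diffeotopy 𝓘(ℝ, E) E, D.stage 1 = s.symm ∧ ∃ R, ∀ t y, R ≤ ‖y‖ → D.toFun t y = y := by
  obtain ⟨D, rfl, R, hs⟩ := h
  refine ⟨D.inv, Diffeomorph.ext fun x => rfl, R, fun t y hy => ?_⟩
  rw [Diffeotopy.inv_toFun]
  exact D.invFun_eq_self_of_toFun hs t y hy

/-- The identity is reached (by the constant diffeotopy). [folklore] -/
theorem exists_compactDiffeotopy_refl :
    ∃ D : Diffeotopy 𝓘(ℝ, E) E, D.stage 1 = Diffeomorph.refl 𝓘(ℝ, E) E ∞ ∧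
      ∃ R : ℝ, ∀ t y, R ≤ ‖y‖ → D.toFun t y = y :=
  ⟨Diffeotopy.refl _ _, Diffeomorph.ext fun _ => rfl, 0, fun _ _ _ => rfl⟩

end Group

/-! ### Transport along continuous linear equivalences -/

section Transport

variable {E : Type*} [NormedAddCommGroup E] [NormedSpace ℝ E]
  {E' : Type*} [NormedAddCommGroup E'] [NormedSpace ℝ E']

/-- A bounded linear map carries the complement of a large ball into the complement of a given
ball: if `‖y‖ ≥ ‖e⁻¹‖ |R| + 1` then `‖e y‖ ≥ R`. [folklore] -/
theorem le_norm_of_le_norm_symm (e : E ≃L[ℝ] E') (R : ℝ) (y : E)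
    (hy : ‖(e.symm : E' →L[ℝ] E)‖ * |R| + 1 ≤ ‖y‖) : R ≤ ‖e y‖ := by
  by_contra hlt
  rw [not_le] at hlt
  have h1 : ‖y‖ ≤ ‖(e.symm : E' →L[ℝ] E)‖ * ‖e y‖ := by
    conv_lhs => rw [← e.symm_apply_apply y]
    exact (e.symm : E' →L[ℝ] E).le_opNorm (e y)
  have h2 : ‖(e.symm : E' →L[ℝ] E)‖ * ‖e y‖ ≤ ‖(e.symm : E' →L[ℝ] E)‖ * |R| :=
    mul_le_mul_of_nonneg_left (hlt.le.trans (le_abs_self R)) (norm_nonneg _)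
  linarith

/-- **Transport of the radius-free form along a continuous linear equivalence**: conjugate the
diffeomorphism into `E`, take a compactly supported diffeotopy there, and transport it back
(`Diffeotopy.mapEquiv`); linear maps carry complements of large balls into complements of
balls. [folklore] -/
theorem CompactDiffeotopyTrivial.of_continuousLinearEquiv (e : E ≃L[ℝ] E')
    (h : CompactDiffeotopyTrivial E) : CompactDiffeotopyTrivial E' := by
  intro s' R hs'
  set T : E ≃ₘ⟮𝓘(ℝ, E), 𝓘(ℝ, E')⟯ E' := e.toDiffeomorph with hT
  set s : E ≃ₘ⟮𝓘(ℝ, E), 𝓘(ℝ, E)⟯ E := T.trans (s'.trans T.symm) with hs_def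
  have hs : ∀ y, ‖(e.symm : E' →L[ℝ] E)‖ * |R| + 1 ≤ ‖y‖ → s y = y := by
    intro y hy
    simp only [hs_def, hT, Diffeomorph.coe_trans, comp_apply, ContinuousLinearEquiv.coe_toDiffeomorph,
      ContinuousLinearEquiv.coe_toDiffeomorph_symm]
    rw [hs' _ (le_norm_of_le_norm_symm e R y hy), e.symm_apply_apply]
  obtain ⟨D, hD1, R₁, hD⟩ := h s _ hs
  refine ⟨D.mapEquiv T, ?_, ‖((e.symm.symm : E ≃L[ℝ] E') : E →L[ℝ] E')‖ * |R₁| + 1, fun t y hy => ?_⟩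
  · rw [Diffeotopy.mapEquiv_stage, hD1, hs_def]
    ext y
    simp [Diffeomorph.coe_trans, hT]
  · rw [Diffeotopy.mapEquiv_toFun]
    have hy' : R₁ ≤ ‖e.symm y‖ := le_norm_of_le_norm_symm e.symm R₁ y hy
    simp only [hT, ContinuousLinearEquiv.coe_toDiffeomorph, ContinuousLinearEquiv.coe_toDiffeomorph_symm]
    rw [hD t _ hy', e.apply_symm_apply]

/-- **Transport of the unit-ball form along a continuous linear equivalence** (through the
radius-free form, `compactDiffeotopyTrivial_iff_unitBall`). [folklore] -/
theorem UnitBallDiffeotopyTrivial.of_continuousLinearEquiv (e : E ≃L[ℝ] E')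
    (h : UnitBallDiffeotopyTrivial E) : UnitBallDiffeotopyTrivial E' :=
  UnitBallDiffeotopyTrivial.of_compact
    (CompactDiffeotopyTrivial.of_continuousLinearEquiv e (CompactDiffeotopyTrivial.of_unitBall h))

end Transport

/-! ### Fibrewise convexity: diffeomorphisms moving points in a fixed direction -/

section Fibrewise

variable {E : Type*} [NormedAddCommGroup E] [NormedSpace ℝ E]

/-- A continuous injective map `m : ℝ → ℝ` which is the identity outside a bounded set is
strictly increasing. [folklore] -/
theorem strictMono_of_injective_of_eq_self {m : ℝ → ℝ} (hc : Continuous m) (hi : Injective m)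
    {A : ℝ} (hA : ∀ x, A ≤ |x| → m x = x) : StrictMono m := by
  rcases hc.strictMono_of_inj hi with h | h
  · exact h
  · exfalso
    set a : ℝ := |A| + 1 with ha
    have ha0 : 0 < a := by rw [ha]; positivity
    have haa : |a| = a := abs_of_pos ha0
    have h1 : m a = a := hA a (by rw [haa, ha]; linarith [le_abs_self A])
    have h2 : m (-a) = -a := hA (-a) (by rw [abs_neg, haa, ha]; linarith [le_abs_self A])
    have := h (show -a < a by linarith)
    rw [h1, h2] at this
    linarith

/-- The rank-one perturbation `v ↦ v + κ (φ v) e₁` of the identity is invertible when the pivot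
`1 + κ φ e₁` is nonzero (Sherman–Morrison: the inverse is `w ↦ w - (κ / (1 + κ φ e₁)) (φ w) e₁`),
as a continuous linear equivalence. [folklore] -/
theorem exists_continuousLinearEquiv_rankOne (φ : E →L[ℝ] ℝ) (e₁ : E) (κ : ℝ)
    (h : 1 + κ * φ e₁ ≠ 0) :
    ∃ L : E ≃L[ℝ] E, (L : E →L[ℝ] E) = ContinuousLinearMap.id ℝ E + (κ • φ).smulRight e₁ :=
  ⟨ContinuousLinearEquiv.equivOfInverse
    (ContinuousLinearMap.id ℝ E + (κ • φ).smulRight e₁)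
    (ContinuousLinearMap.id ℝ E - ((κ / (1 + κ * φ e₁)) • φ).smulRight e₁)
    (fun v => by
      have hφ : φ (v + (κ * φ v) • e₁) = φ v * (1 + κ * φ e₁) := by
        rw [map_add, map_smul, smul_eq_mul]; ring
      show (v + (κ * φ v) • e₁) - (κ / (1 + κ * φ e₁) * φ (v + (κ * φ v) • e₁)) • e₁ = v
      rw [hφ, show κ / (1 + κ * φ e₁) * (φ v * (1 + κ * φ e₁)) = κ * φ v by field_simp]
      abel)
    (fun w => by
      have hφ : φ (w - (κ / (1 + κ * φ e₁) * φ w) • e₁) = φ w / (1 + κ * φ e₁) := by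
        rw [map_sub, map_smul, smul_eq_mul]; field_simp; ring
      show (w - (κ / (1 + κ * φ e₁) * φ w) • e₁) + (κ * φ (w - (κ / (1 + κ * φ e₁) * φ w) • e₁)) • e₁ = w
      rw [hφ, show κ * (φ w / (1 + κ * φ e₁)) = κ / (1 + κ * φ e₁) * φ w by ring]
      abel), rfl⟩

/-- **Fibrewise convexity** (Cerf 1968, Appendice §5, p. 131: "le groupe des difféomorphismes de
`R` conservant l'orientation est convexe"; the last step of Smale's proof of Thm. B). Let `u` be a
diffeomorphism of the real Banach space `E` which is the identity off the ball `B̄(0, R)` and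
moves every point in the fixed direction `e₁ ≠ 0` only: `u p = p + c • e₁` for some scalar
`c = c(p)`. Then `u` is the time-one stage of a diffeotopy of `E` all of whose stages are the
identity off `B̄(0, R)` — the straight-line family `p + λ(t)(u p - p)`: on every line `p + ℝ e₁`
the map `u` is an increasing diffeomorphism equal to the identity far out, so each stage is a
bijection, and its derivative `id + λ(t) (Dg(p) ·) e₁` (`u = id + g e₁`) is a rank-one
perturbation of the identity with pivot `(1 - λ) + λ (1 + Dg(p) e₁) > 0`.
[cite: CerfDiffeoSphere1968, Appendice §5, p. 131] -/
theorem exists_compactDiffeotopy_of_forall_sub_mem_span [CompleteSpace E] (u : E ≃ₘ⟮𝓘(ℝ, E), 𝓘(ℝ, E)⟯ E)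
    {e₁ : E} (he₁ : e₁ ≠ 0) (hu : ∀ p, ∃ c : ℝ, u p = p + c • e₁) {R : ℝ}
    (hR : ∀ p, R ≤ ‖p‖ → u p = p) :
    ∃ D : Diffeotopy 𝓘(ℝ, E) E, D.stage 1 = u ∧ ∀ t p, R ≤ ‖p‖ → D.toFun t p = p := by
  -- a coordinate `ℓ` with `ℓ e₁ = 1`, and the displacement `g = ℓ ∘ (u - id)`
  have hne : ‖e₁‖ ≠ 0 := norm_ne_zero_iff.mpr he₁
  obtain ⟨ℓ₀, -, hℓ₀⟩ := exists_dual_vector ℝ e₁ hne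
  set ℓ : E →L[ℝ] ℝ := ‖e₁‖⁻¹ • ℓ₀ with hℓ
  have hℓe : ℓ e₁ = 1 := by
    simp only [hℓ, FunLike.coe_smul, Pi.smul_apply, hℓ₀, smul_eq_mul,
      RCLike.ofReal_real_eq_id, id_eq, inv_mul_cancel₀ hne]
  have huc : ContDiff ℝ ∞ (u : E → E) := contMDiff_iff_contDiff.mp u.contMDiff
  set g : E → ℝ := fun p => ℓ (u p - p) with hg
  have hgc : ContDiff ℝ ∞ g := ℓ.contDiff.comp (huc.sub contDiff_id)
  have hgd : Differentiable ℝ g := hgc.differentiable (by simp)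
  have hug : ∀ p, u p = p + g p • e₁ := by
    intro p
    obtain ⟨c, hc⟩ := hu p
    have : g p = c := by simp only [hg, hc, add_sub_cancel_left, map_smul, hℓe, smul_eq_mul, mul_one]
    rw [this, hc]
  have hgR : ∀ p, R ≤ ‖p‖ → g p = 0 := fun p hp => by simp only [hg, hR p hp, sub_self, map_zero]
  -- the pivot `a p = 1 + Dg(p) e₁` is positive
  set a : E → ℝ := fun p => 1 + fderiv ℝ g p e₁ with ha
  have hDu : ∀ p, fderiv ℝ u p e₁ = a p • e₁ := by
    intro p
    have h1 : HasFDerivAt (u : E → E) (ContinuousLinearMap.id ℝ E + (fderiv ℝ g p).smulRight e₁) p := by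
      have := (hasFDerivAt_id p).add ((hgd p).hasFDerivAt.smul_const e₁)
      exact this.congr_of_eventuallyEq (Eventually.of_forall fun q => hug q)
    rw [h1.fderiv]
    simp only [FunLike.coe_add, Pi.add_apply, ContinuousLinearMap.id_apply,
      ContinuousLinearMap.smulRight_apply, ha, add_smul, one_smul]
  have ha_ne : ∀ p, a p ≠ 0 := by
    intro p h0
    have h1 : fderiv ℝ u p e₁ = 0 := by rw [hDu, h0, zero_smul]
    obtain ⟨w, hw⟩ := Diffeomorph.isUnit_fderiv u p
    apply he₁
    calc e₁ = ((↑(w⁻¹ * w) : E →L[ℝ] E)) e₁ := by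
          rw [inv_mul_cancel, Units.val_one]; rfl
      _ = ((↑w⁻¹ : (E →L[ℝ] E)ˣ) : E →L[ℝ] E) ((↑w : E →L[ℝ] E) e₁) := rfl
      _ = 0 := by rw [hw, h1, map_zero]
  -- the row maps `m p : x ↦ x + g (p + x e₁)` are strictly increasing with derivative `a`
  have hm_deriv : ∀ p x, HasDerivAt (fun x : ℝ => x + g (p + x • e₁)) (a (p + x • e₁)) x := by
    intro p x
    have h1 : HasDerivAt (fun x : ℝ => p + x • e₁) e₁ x := by
      simpa using ((hasDerivAt_id x).smul_const e₁).const_add p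
    have h2 : HasDerivAt (fun x : ℝ => g (p + x • e₁)) (fderiv ℝ g (p + x • e₁) e₁) x :=
      (hgd _).hasFDerivAt.comp_hasDerivAt x h1
    exact (hasDerivAt_id x).add h2
  have ha_pos : ∀ p, 0 < a p := by
    intro p
    -- the row map through `p`
    set m : ℝ → ℝ := fun x => x + g (p + x • e₁) with hm
    have hmc : Continuous m := continuous_id.add (hgc.continuous.comp (by fun_prop))
    have hmi : Injective m := by
      intro x x' h
      have h1 : u (p + x • e₁) = u (p + x' • e₁) := by
        rw [hug, hug, add_assoc, add_assoc, ← add_smul, ← add_smul]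
        exact congrArg (fun c : ℝ => p + c • e₁) h
      have h2 := u.injective h1
      rw [add_right_inj] at h2
      exact smul_left_injective ℝ he₁ h2
    have hmA : ∀ x, (|R| + ‖p‖) / ‖e₁‖ ≤ |x| → m x = x := by
      intro x hx
      have hn : 0 < ‖e₁‖ := norm_pos_iff.mpr he₁
      have h1 : R ≤ ‖p + x • e₁‖ := by
        have h2 : |x| * ‖e₁‖ - ‖p‖ ≤ ‖p + x • e₁‖ := by
          have := norm_sub_norm_le (x • e₁) (-p)
          rw [norm_smul, Real.norm_eq_abs, norm_neg, sub_neg_eq_add, add_comm] at this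
          linarith
        rw [div_le_iff₀ hn] at hx
        linarith [le_abs_self R]
      simp only [hm, hgR _ h1, add_zero]
    have hmono := strictMono_of_injective_of_eq_self hmc hmi hmA
    have h0 : 0 ≤ a (p + (0 : ℝ) • e₁) := by
      rw [← (hm_deriv p 0).deriv]
      exact hmono.monotone.deriv_nonneg
    rw [zero_smul, add_zero] at h0
    exact lt_of_le_of_ne h0 (Ne.symm (ha_ne p))
  -- the straight-line family
  set χ := Real.smoothTransition with hχ
  have hχ0 : ∀ t, 0 ≤ χ t := Real.smoothTransition.nonneg
  have hχ1 : ∀ t, χ t ≤ 1 := Real.smoothTransition.le_one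
  set Φ : ℝ → E → E := fun t p => p + (χ t * g p) • e₁ with hΦ
  have hpivot : ∀ t p, 0 < 1 + χ t * fderiv ℝ g p e₁ := by
    intro t p
    have h1 : 1 + χ t * fderiv ℝ g p e₁ = (1 - χ t) + χ t * a p := by simp only [ha]; ring
    rw [h1]
    rcases (hχ0 t).eq_or_lt with h0 | h0
    · rw [← h0]; norm_num
    · nlinarith [hχ1 t, ha_pos p]
  have hΦderiv : ∀ t p, HasFDerivAt (Φ t)
      (ContinuousLinearMap.id ℝ E + (χ t • fderiv ℝ g p).smulRight e₁) p := by
    intro t p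
    exact (hasFDerivAt_id p).add (((hgd p).hasFDerivAt.const_mul (χ t)).smul_const e₁)
  -- stages restricted to rows
  have hrow : ∀ t p x, Φ t (p + x • e₁) = p + (x + χ t * g (p + x • e₁)) • e₁ := by
    intro t p x; simp only [hΦ, add_smul, add_assoc]
  have hrow_deriv : ∀ t p x, HasDerivAt (fun x : ℝ => x + χ t * g (p + x • e₁))
      (1 + χ t * fderiv ℝ g (p + x • e₁) e₁) x := by
    intro t p x
    have h1 : HasDerivAt (fun x : ℝ => p + x • e₁) e₁ x := by
      simpa using ((hasDerivAt_id x).smul_const e₁).const_add p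
    have h2 : HasDerivAt (fun x : ℝ => g (p + x • e₁)) (fderiv ℝ g (p + x • e₁) e₁) x :=
      (hgd _).hasFDerivAt.comp_hasDerivAt x h1
    exact (hasDerivAt_id x).add (h2.const_mul _)
  have hrow_mono : ∀ t p, StrictMono fun x : ℝ => x + χ t * g (p + x • e₁) := fun t p =>
    strictMono_of_deriv_pos fun x => by rw [(hrow_deriv t p x).deriv]; exact hpivot t _
  have hrow_cont : ∀ t p, Continuous fun x : ℝ => x + χ t * g (p + x • e₁) := fun t p =>
    continuous_id.add (continuous_const.mul (hgc.continuous.comp (by fun_prop)))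
  have hΦfix : ∀ t p, R ≤ ‖p‖ → Φ t p = p := fun t p hp => by
    simp only [hΦ, hgR p hp, mul_zero, zero_smul, add_zero]
  have hinj : ∀ t, Injective (Φ t) := by
    intro t q q' h
    -- `q'` lies on the row of `q`
    set y : ℝ := χ t * g q - χ t * g q' with hy
    have hq' : q' = q + y • e₁ := by
      have h1 : q + (χ t * g q) • e₁ = q' + (χ t * g q') • e₁ := h
      have h2 : q' = q + (χ t * g q) • e₁ - (χ t * g q') • e₁ := eq_sub_of_add_eq h1.symm
      rw [h2, hy, sub_smul]
      abel
    have h2 : (fun x : ℝ => x + χ t * g (q + x • e₁)) 0 = (fun x : ℝ => x + χ t * g (q + x • e₁)) y := by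
      have h3 : Φ t (q + (0 : ℝ) • e₁) = Φ t (q + y • e₁) := by rw [zero_smul, add_zero, ← hq', h]
      rw [hrow, hrow] at h3
      have h4 := add_left_cancel h3
      exact smul_left_injective ℝ he₁ h4
    have h5 : (0 : ℝ) = y := (hrow_mono t q).injective h2
    rw [hq', ← h5, zero_smul, add_zero]
  have hsurj : ∀ t, Surjective (Φ t) := by
    intro t w
    -- solve on the row of `w`: find `x` with `x + χ g (w + x e₁) = 0`
    set n : ℝ → ℝ := fun x => x + χ t * g (w + x • e₁) with hn
    have hn_far : ∀ x, (|R| + ‖w‖) / ‖e₁‖ ≤ |x| → n x = x := by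
      intro x hx
      have hne' : 0 < ‖e₁‖ := norm_pos_iff.mpr he₁
      have h1 : R ≤ ‖w + x • e₁‖ := by
        have h2 : |x| * ‖e₁‖ - ‖w‖ ≤ ‖w + x • e₁‖ := by
          have := norm_sub_norm_le (x • e₁) (-w)
          rw [norm_smul, Real.norm_eq_abs, norm_neg, sub_neg_eq_add, add_comm] at this
          linarith
        rw [div_le_iff₀ hne'] at hx
        linarith [le_abs_self R]
      simp only [hn, hgR _ h1, mul_zero, add_zero]
    set B : ℝ := (|R| + ‖w‖) / ‖e₁‖ + 1 with hB
    have hB0 : 0 ≤ (|R| + ‖w‖) / ‖e₁‖ := by positivity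
    have hB1 : 0 < B := by rw [hB]; positivity
    have hBabs : |B| = B := abs_of_pos hB1
    have hnB : n B = B := hn_far B (by rw [hBabs, hB]; linarith)
    have hnB' : n (-B) = -B := hn_far (-B) (by rw [abs_neg, hBabs, hB]; linarith)
    have h0 : (0 : ℝ) ∈ Icc (n (-B)) (n B) := by rw [hnB, hnB']; constructor <;> linarith
    obtain ⟨x, -, hx⟩ := intermediate_value_Icc (by linarith) (hrow_cont t w).continuousOn h0
    refine ⟨w + x • e₁, ?_⟩
    rw [hrow]
    have hx' : x + χ t * g (w + x • e₁) = 0 := hx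
    rw [hx', zero_smul, add_zero]
  have hsmooth : ContDiff ℝ ∞ (uncurry Φ) := by
    show ContDiff ℝ ∞ fun q : ℝ × E => q.2 + (χ q.1 * g q.2) • e₁
    exact contDiff_snd.add (((Real.smoothTransition.contDiff.comp contDiff_fst).mul
      (hgc.comp contDiff_snd)).smul contDiff_const)
  set A : AmbientIsotopy 𝓘(ℝ, E) E :=
    { toFun := Φ
      contMDiff := contMDiff_prod_self_of_contDiff hsmooth
      bijective := fun t => ⟨hinj t, hsurj t⟩
      isLocalDiffeomorph := fun t p => by
        have hstage : ContDiff ℝ ∞ (Φ t) := hsmooth.comp (contDiff_const.prodMk contDiff_id)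
        obtain ⟨L, hL⟩ := exists_continuousLinearEquiv_rankOne (fderiv ℝ g p) e₁ (χ t) (hpivot t p).ne'
        refine isLocalDiffeomorphAt_of_hasFDerivAt_writtenInExtChartAt (U := univ) isOpen_univ
          (mem_univ p) hstage.contMDiff.contMDiffOn (by simp) L ?_
        rw [hL]
        exact hΦderiv t p
      map_zero := by
        funext p
        simp [hΦ, hχ, Real.smoothTransition.zero] } with hA
  refine ⟨A.toDiffeotopy, ?_, fun t p hp => ?_⟩
  · rw [AmbientIsotopy.toDiffeotopy_stage]
    ext p
    simp only [AmbientIsotopy.coe_toDiffeomorph, hA, hΦ, hχ, Real.smoothTransition.one, one_mul]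
    exact (hug p).symm
  · rw [AmbientIsotopy.toDiffeotopy_toFun]
    exact hΦfix t p hp

/-- **Smale's reduction scheme.** Let `s` be a diffeomorphism of `E` which is the identity off a
ball, and suppose some diffeomorphism `Φ` reached by a compactly supported diffeotopy
straightens the image under `s` of the foliation by lines parallel to `e₁ ≠ 0`, in the sense
that `s⁻¹ (Φ p) - p ∈ ℝ e₁` for every `p`. Then `s` is reached by a compactly supported
diffeotopy: `u := s⁻¹ ∘ Φ` is compactly supported and moves points in the direction `e₁` only,
so `u` is reached by one (`exists_compactDiffeotopy_of_forall_sub_mem_span`), and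
`s = Φ ∘ u⁻¹`. [cite: CerfDiffeoSphere1968, Appendice §5, Théorème 4] -/
theorem exists_compactDiffeotopy_of_straightening [CompleteSpace E] (s Φ : E ≃ₘ⟮𝓘(ℝ, E), 𝓘(ℝ, E)⟯ E) {e₁ : E}
    (he₁ : e₁ ≠ 0) {R : ℝ} (hs : ∀ p, R ≤ ‖p‖ → s p = p)
    (hΦ : ∃ D : Diffeotopy 𝓘(ℝ, E) E, D.stage 1 = Φ ∧ ∃ R', ∀ t y, R' ≤ ‖y‖ → D.toFun t y = y)
    (hstr : ∀ p, ∃ c : ℝ, s.symm (Φ p) = p + c • e₁) :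
    ∃ D : Diffeotopy 𝓘(ℝ, E) E, D.stage 1 = s ∧ ∃ R', ∀ t y, R' ≤ ‖y‖ → D.toFun t y = y := by
  obtain ⟨DΦ, hDΦ1, RΦ, hDΦ⟩ := hΦ
  have hΦsupp : ∀ p, RΦ ≤ ‖p‖ → Φ p = p := fun p hp => by
    rw [← hDΦ1, Diffeotopy.coe_stage]; exact hDΦ 1 p hp
  set u : E ≃ₘ⟮𝓘(ℝ, E), 𝓘(ℝ, E)⟯ E := Φ.trans s.symm with hu_def
  have hu : ∀ p, ∃ c : ℝ, u p = p + c • e₁ := fun p => by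
    simp only [hu_def, Diffeomorph.coe_trans, comp_apply]; exact hstr p
  have husupp : ∀ p, max R RΦ ≤ ‖p‖ → u p = p := by
    intro p hp
    simp only [hu_def, Diffeomorph.coe_trans, comp_apply]
    rw [hΦsupp p ((le_max_right _ _).trans hp)]
    conv_lhs => rw [← hs p ((le_max_left _ _).trans hp)]
    exact s.symm_apply_apply p
  obtain ⟨Du, hDu1, hDu⟩ := exists_compactDiffeotopy_of_forall_sub_mem_span u he₁ hu husupp
  have hu' : ∃ D : Diffeotopy 𝓘(ℝ, E) E, D.stage 1 = u ∧ ∃ R', ∀ t y, R' ≤ ‖y‖ → D.toFun t y = y :=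
    ⟨Du, hDu1, _, hDu⟩
  obtain ⟨D, hD1, hD⟩ := exists_compactDiffeotopy_trans (exists_compactDiffeotopy_symm hu')
    ⟨DΦ, hDΦ1, RΦ, hDΦ⟩
  refine ⟨D, hD1.trans ?_, hD⟩
  ext y
  have h1 : (Φ.trans s.symm).symm y = Φ.symm (s y) := rfl
  rw [hu_def, Diffeomorph.coe_trans, comp_apply, h1, Diffeomorph.apply_symm_apply]

end Fibrewise

end Literature.Topology.FourManifolds

end
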